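import Literature.NumberTheory.PAdicHodge.DualExpEllipticTower
import Literature.NumberTheory.GaloisRepresentations.AbsGaloisGroupProofs
import HarnessLib

/-!
# (S5b) is the trivial-tower case of (S5b-tower): the single-field Tate-duality range of `exp*_ω`
# follows from the simultaneous Néron normalisation

Topic `Literature/NumberTheory/PAdicHodge`; theorem-only sequel to `DualExpEllipticTower.lean` (no definition,
no named fact, no `sorry`, no instance). The module docstring of `DualExpEllipticTower` records that the tower
fact `exists_smul_range_expStarCoord_tower_iff_trace_log` «at `F = F₀` is
`exists_smul_range_expStarCoord_iff_trace_log`»; this file PROVES that implication in the kernel, so that the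
single-field fact (S5b) is no longer an independent cite hypothesis of its consumers (cell `bsd-addord`, rung W2 of
`BirchSwinnertonDyer`: crux `stmt-BirchSwinnertonDyer-19560` and the cite-only closers of 19075 / 19076 / 19679 /
19562 / 20013).

The only point is that the tree's restriction map along the identity `F`-algebra structure,
`absGaloisRestrict F F : Γ_F → Γ_F`, is not the identity but an INNER automorphism `σ ↦ σ₀⁻¹ σ σ₀`
(`absGaloisRestrict_isConj_of_algHom_holds`; restriction is only defined up to conjugacy). Hence the self-tower
representation `V_pW|_{Γ_F}|_{Γ_F}` is `V_pW|_{Γ_F}` conjugated by `ρ(σ₀)`: the line datum transports along the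
intertwining isomorphism `ρ(σ₀⁻¹)` (`FilZeroLine.map`), so do the Prop-1.2.3 binders
(`cupLogInjective_of_equiv`, `HasDualExp.map`) and the scalar `exp*_ω` (`dualExpCoord_map`), and a crossed
homomorphism `η₀ ∘ inn(σ₀)` is cohomologous to `ρ(σ₀⁻¹) ∘ η₀` (the coboundary of `ρ(σ₀⁻¹) η₀(σ₀)`), which gives
the compatibility clause of the tower fact. Applying the tower fact to this trivial tower and keeping its first
conjunct is (S5b).

* `PeriodRingData.cupLogInjective_of_equiv` — injectivity of `x ↦ x ∪ ψ` on `Fil⁰ D` transports along an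
  isomorphism of representations (abstract period-ring data).
* `exists_smul_range_expStarCoord_iff_trace_log_of_tower` — **(S5b-tower) ⇒ (S5b)**.

References: K. Kato, LNM 1553 (1993), Ch. II §1.2.4, Thm. 1.4.1 [Kato1993LNM1553]; S. Bloch, K. Kato (1990),
Prop. 3.8, Ex. 3.11 [BlochKato1990]; J. S. Milne, *Fields and Galois Theory*, Ch. 7 (the absolute Galois group
is defined up to an inner automorphism) [MilneFT2022]; J.-P. Serre, *Galois Cohomology*, I §5.1 [SerreGaloisCohomology1997].
-/

noncomputable section

open scoped TensorProduct NNReal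
open Field ValuativeRel
open Literature.NumberTheory.GaloisRepresentations
open Literature.NumberTheory.GaloisRepresentations.IsNonarchimedeanLocalField
open Literature.NumberTheory.EllipticCurves WeierstrassCurve

/-! ### Injectivity of the cup product transports along an isomorphism of representations -/

namespace Literature.NumberTheory.GaloisRepresentations.PeriodRingData

universe u v v' w w'

variable {Γ : Type u} [Group Γ] [TopologicalSpace Γ] {P : Type v} {E : Type v'} [Field P]
  [TopologicalSpace P] [Field E] [Algebra P E]
  {M : Type w'} [AddCommGroup M] [Module P M] [TopologicalSpace M]
  {M' : Type w'} [AddCommGroup M'] [Module P M'] [TopologicalSpace M']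
  {𝔅 : PeriodRingData.{u, v, v', w} Γ P E} {ψ : Γ → P} {ρ : ContinuousRep Γ P M}
  {ρ' : ContinuousRep Γ P M'}

/-- An intertwining isomorphism intertwines backwards. [folklore] -/
private theorem symm_intertwines_of_intertwines (φ : M ≃ₗ[P] M') (hφ : ∀ σ m, φ (ρ σ m) = ρ' σ (φ m))
    (σ : Γ) (m' : M') : φ.symm (ρ' σ m') = ρ σ (φ.symm m') :=
  φ.injective (by rw [LinearEquiv.apply_symm_apply, hφ, LinearEquiv.apply_symm_apply])

omit [TopologicalSpace Γ] [TopologicalSpace P] [TopologicalSpace M] [TopologicalSpace M'] in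
/-- `(id ⊗ φ) ((id ⊗ φ⁻¹) x) = x`. [folklore] -/
private theorem tensorMap_tensorMap_symm_apply (φ : M ≃ₗ[P] M') (x : 𝔅.B ⊗[P] M') :
    𝔅.tensorMap (φ : M →ₗ[P] M') (𝔅.tensorMap (φ.symm : M' →ₗ[P] M) x) = x := by
  induction x using TensorProduct.induction_on with
  | zero => simp
  | tmul b m => simp
  | add x y hx hy => simp only [map_add, hx, hy]

/-- **Injectivity of `x ↦ x ∪ ψ` on `Fil⁰ D(V)` is invariant under isomorphism of representations**
`φ : V ≃ V'` intertwining `ρ, ρ'`: pull a would-be kernel element of `V'` back along `id ⊗ φ⁻¹`.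
[cite: Kato1993LNM1553, Ch. II Prop. 1.2.3 and §1.2.4] -/
theorem cupLogInjective_of_equiv (φ : M ≃ₗ[P] M') (hφ : ∀ σ m, φ (ρ σ m) = ρ' σ (φ m))
    (h : 𝔅.CupLogInjective ψ ρ) : 𝔅.CupLogInjective ψ ρ' := by
  intro x hx hfil hcob
  have hφ' : ∀ σ m', φ.symm (ρ' σ m') = ρ σ (φ.symm m') := symm_intertwines_of_intertwines φ hφ
  have hx' : 𝔅.tensorMap (φ.symm : M' →ₗ[P] M) x = 0 :=
    h _ (tensorMap_mem_D hφ' hx) (tensorMap_mem_filTensor 0 hfil)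
      ((hcob.map hφ').congr fun σ => by rw [map_smul])
  rw [← tensorMap_tensorMap_symm_apply (𝔅 := 𝔅) φ x, hx', map_zero]

end Literature.NumberTheory.GaloisRepresentations.PeriodRingData

namespace Literature.NumberTheory.PAdicHodge

open Literature.NumberTheory.GaloisRepresentations.PeriodRingData

/-! ### Restriction along `F ≤ F` is an inner automorphism -/

/-- **`absGaloisRestrict F F σ = σ₀⁻¹ σ σ₀`** for one `σ₀ ∈ Γ_F` (the case `ι' = id`, `r' = id` of
`absGaloisRestrict_isConj_of_algHom_holds`; the same statement as
`GaloisRepresentations.exists_absGaloisRestrict_self_eq_conj` of `RestrictFieldSelf.lean`, re-derived here in six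
lines to keep this file's imports inside `PAdicHodge` + `AbsGaloisGroupProofs`).
[cite: MilneFT2022, Ch. 7 (the absolute Galois group)] -/
private theorem exists_absGaloisRestrict_self_eq_conj' (F : Type) [Field F] :
    ∃ σ₀ : absoluteGaloisGroup F, ∀ σ, absGaloisRestrict F F σ = σ₀⁻¹ * σ * σ₀ := by
  obtain ⟨σ₀, hσ₀⟩ := absGaloisRestrict_isConj_of_algHom_holds F F
    (AlgHom.id F (AlgebraicClosure F)) id (fun _ _ => rfl)
  refine ⟨σ₀, fun σ => ?_⟩
  have h := hσ₀ σ
  simp only [id] at h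
  calc absGaloisRestrict F F σ = σ₀⁻¹ * (σ₀ * absGaloisRestrict F F σ * σ₀⁻¹) * σ₀ := by group
    _ = σ₀⁻¹ * σ * σ₀ := by rw [← h]

/-! ### (S5b-tower) ⇒ (S5b) -/

/-- **(S5b) from (S5b-tower).** The single-field Tate-duality range statement
`exists_smul_range_expStarCoord_iff_trace_log` is the trivial-tower case `F = F₀` of
`exists_smul_range_expStarCoord_tower_iff_trace_log` (same printed sources: Kato II Thm. 1.4.1 (3)–(4),
BK90 Prop. 3.8 / Ex. 3.11). The self-restriction `absGaloisRestrict F F` being the inner automorphism by some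
`σ₀`, the tower representation is the conjugate of `V_pW|_{Γ_F}` by `ρ(σ₀)`; the upper line datum is the
transported generator `(id ⊗ ρ(σ₀⁻¹)) ω`, the upper Prop-1.2.3 binders are the transported ones, and the
compatibility clause holds because `η₀ ∘ inn(σ₀)` and `ρ(σ₀⁻¹) ∘ η₀` differ by the coboundary of
`ρ(σ₀⁻¹) η₀(σ₀)` while `exp*_{(id ⊗ φ)ω}(φ ∘ z) = exp*_ω(z)`.
[cite: Kato1993LNM1553, Ch. II Thm. 1.4.1 (3)–(4) and §1.2.4] [cite: BlochKato1990, Prop. 3.8 (p. 354), Example 3.11 (p. 361)]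
[cite: MilneFT2022, Ch. 7 (the absolute Galois group)] -/
theorem exists_smul_range_expStarCoord_iff_trace_log_of_tower
    (hT₂ : exists_smul_range_expStarCoord_tower_iff_trace_log) :
    exists_smul_range_expStarCoord_iff_trace_log := by
  intro K₀ _ _ W _ F _ _ _ _ _ _ p _ _ _ hp _ w _ _ d hinj hex
  -- the inner automorphism behind `absGaloisRestrict F F`
  obtain ⟨σ₀, hσ₀⟩ := exists_absGaloisRestrict_self_eq_conj' F
  -- the intertwiner `ρ(σ₀⁻¹) : (V, ρ) ≃ (V, ρ|_res)`, `res = absGaloisRestrict F F = inn(σ₀)`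
  have hVinv₁ : (restrictedRationalTateRep W F p σ₀⁻¹).comp (restrictedRationalTateRep W F p σ₀) =
      LinearMap.id := by
    rw [← Module.End.mul_eq_comp, ← map_mul, inv_mul_cancel, map_one, Module.End.one_eq_id]
  have hVinv₂ : (restrictedRationalTateRep W F p σ₀).comp (restrictedRationalTateRep W F p σ₀⁻¹) =
      LinearMap.id := by
    rw [← Module.End.mul_eq_comp, ← map_mul, mul_inv_cancel, map_one, Module.End.one_eq_id]
  let gV : W.rationalTateModule p ≃ₗ[ℚ_[p]] W.rationalTateModule p :=
    LinearEquiv.ofLinear (restrictedRationalTateRep W F p σ₀⁻¹) (restrictedRationalTateRep W F p σ₀)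
      hVinv₁ hVinv₂
  have hgV_apply : ∀ m, gV m = restrictedRationalTateRep W F p σ₀⁻¹ m := fun _ => rfl
  have hgV_symm_apply : ∀ m, gV.symm m = restrictedRationalTateRep W F p σ₀ m := fun _ => rfl
  have hgV : ∀ σ m, gV (restrictedRationalTateRep W F p σ m) =
      ((restrictedRationalTateRep W F p).restrict (absGaloisRestrict F F)) σ (gV m) := by
    intro σ m
    rw [hgV_apply, hgV_apply, ContinuousRep.restrict_apply, hσ₀, map_mul, map_mul,
      Module.End.mul_apply, Module.End.mul_apply, ← Module.End.mul_apply (restrictedRationalTateRep W F p σ₀),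
      ← map_mul, mul_inv_cancel, map_one, Module.End.one_apply]
  -- the transported line datum and Prop-1.2.3 binders on the self-tower representation
  have hinj' : (bdRPeriodRingData hp).CupLogInjective (logCyclotomic p)
      ((restrictedRationalTateRep W F p).restrict (absGaloisRestrict F F)) :=
    cupLogInjective_of_equiv gV hgV hinj
  have hex' : ∀ z : contOneCocycles
      ((restrictedRationalTateRep W F p).restrict (absGaloisRestrict F F)).toTopRep,
      (bdRPeriodRingData hp).HasDualExp (logCyclotomic p)
        ((restrictedRationalTateRep W F p).restrict (absGaloisRestrict F F)) fun σ => z.1 σ := by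
    intro z
    -- pull `z` back along `gV⁻¹ = ρ(σ₀)` to a crossed homomorphism of `ρ`, apply `hex`, push forward
    let z₀ : contOneCocycles (restrictedRationalTateRep W F p).toTopRep :=
      ⟨⟨fun σ => gV.symm (z.1 σ),
          ((restrictedRationalTateRep W F p).continuous_apply σ₀).comp z.1.continuous⟩,
        fun g h => by
          change gV.symm (z.1 (g * h)) =
            gV.symm (z.1 g) + restrictedRationalTateRep W F p g (gV.symm (z.1 h))
          rw [z.2 g h, map_add]
          congr 1
          exact symm_intertwines_of_intertwines gV hgV g (z.1 h)⟩
    have h := HasDualExp.map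
      (φ := (gV : W.rationalTateModule p →ₗ[ℚ_[p]] W.rationalTateModule p)) hgV (hex z₀)
    have hfun : (fun σ => (gV : W.rationalTateModule p →ₗ[ℚ_[p]] W.rationalTateModule p) (z₀.1 σ)) =
        fun σ => z.1 σ :=
      funext fun σ => gV.apply_symm_apply (z.1 σ)
    rw [hfun] at h
    exact h
  -- compatibility of the line data under the (inner) restriction
  have hcompat : ∀ (η₀ : contOneCocycles (restrictedTateRep W F p).toTopRep)
      (η : contOneCocycles ((restrictedTateRep W F p).restrict (absGaloisRestrict F F)).toTopRep),
      (∀ σ, η.1 σ = η₀.1 (absGaloisRestrict F F σ)) →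
      expStarCoordTower W hp (d.map gV hgV) η = algebraMap F F (expStarCoord W hp d η₀) := by
    intro η₀ η hη
    -- the push-forward of `η₀` to `V_pW`, a continuous crossed homomorphism of `ρ`
    haveI : Module.Finite ℤ_[p] (W.tateModule p) := W.module_finite_tateModule_holds p
    let Z₀ : contOneCocycles (restrictedRationalTateRep W F p).toTopRep :=
      ⟨⟨fun σ => TateModule.toRational p (η₀.1 σ),
          (TateModule.continuous_toRational p).comp η₀.1.continuous⟩,
        fun g h => by
          change TateModule.toRational p (η₀.1 (g * h)) = TateModule.toRational p (η₀.1 g) +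
            restrictedRationalTateRep W F p g (TateModule.toRational p (η₀.1 h))
          rw [η₀.2 g h]
          change TateModule.toRational p (η₀.1 g + absGaloisRestrict K₀ F g • η₀.1 h) = _
          rw [map_add, restrictedRationalTateRep_toRational]⟩
    -- (A) `η = η₀ ∘ inn(σ₀)` is cohomologous to `ρ(σ₀⁻¹) ∘ η₀` (coboundary of `v = ρ(σ₀⁻¹) η₀(σ₀)`)
    have hT : ∀ σ, η.1 σ = absGaloisRestrict K₀ F σ₀⁻¹ • η₀.1 σ +
        (absGaloisRestrict K₀ F (σ₀⁻¹ * σ * σ₀) • (absGaloisRestrict K₀ F σ₀⁻¹ • η₀.1 σ₀) -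
          absGaloisRestrict K₀ F σ₀⁻¹ • η₀.1 σ₀) := by
      intro σ
      have hc : ∀ g h : absoluteGaloisGroup F,
          η₀.1 (g * h) = η₀.1 g + absGaloisRestrict K₀ F g • η₀.1 h := fun g h => η₀.2 g h
      have hinv : η₀.1 σ₀⁻¹ = -(absGaloisRestrict K₀ F σ₀⁻¹ • η₀.1 σ₀) := by
        have h1 := hc σ₀⁻¹ σ₀
        rw [inv_mul_cancel, contOneCocycles.apply_one] at h1
        rw [eq_neg_iff_add_eq_zero, h1]
      have hcan : absGaloisRestrict K₀ F (σ₀⁻¹ * σ * σ₀) • (absGaloisRestrict K₀ F σ₀⁻¹ • η₀.1 σ₀) =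
          absGaloisRestrict K₀ F σ₀⁻¹ • (absGaloisRestrict K₀ F σ • η₀.1 σ₀) := by
        rw [← mul_smul, ← map_mul, show σ₀⁻¹ * σ * σ₀ * σ₀⁻¹ = σ₀⁻¹ * σ by group, map_mul, mul_smul]
      rw [hcan, hη σ, hσ₀ σ, hc, hc, hinv, map_mul, mul_smul]
      abel
    have hzz' : ∀ σ, TateModule.toRational p (η.1 σ) =
        gV (Z₀.1 σ) +
          (((restrictedRationalTateRep W F p).restrict (absGaloisRestrict F F)) σ
              (gV (TateModule.toRational p (η₀.1 σ₀))) -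
            gV (TateModule.toRational p (η₀.1 σ₀))) := by
      intro σ
      change TateModule.toRational p (η.1 σ) = gV (TateModule.toRational p (η₀.1 σ)) + _
      rw [hT σ, hgV_apply, hgV_apply, ContinuousRep.restrict_apply, hσ₀, map_add, map_sub,
        restrictedRationalTateRep_toRational, restrictedRationalTateRep_toRational,
        restrictedRationalTateRep_toRational]
    have hA : (bdRPeriodRingData hp).dualExpCoord (logCyclotomic p)
        ((restrictedRationalTateRep W F p).restrict (absGaloisRestrict F F)) (d.map gV hgV).ω
          (fun σ => TateModule.toRational p (η.1 σ)) =
        (bdRPeriodRingData hp).dualExpCoord (logCyclotomic p)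
          ((restrictedRationalTateRep W F p).restrict (absGaloisRestrict F F)) (d.map gV hgV).ω
          (fun σ => gV (Z₀.1 σ)) :=
      dualExpCoord_congr_coboundary _ hzz'
    -- (B) `exp*_{(id ⊗ gV) ω}(gV ∘ Z₀) = exp*_ω(Z₀)`
    have hB : (bdRPeriodRingData hp).dualExpCoord (logCyclotomic p)
        ((restrictedRationalTateRep W F p).restrict (absGaloisRestrict F F)) (d.map gV hgV).ω
          (fun σ => gV (Z₀.1 σ)) =
        (bdRPeriodRingData hp).dualExpCoord (logCyclotomic p) (restrictedRationalTateRep W F p) d.ω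
          (fun σ => Z₀.1 σ) :=
      FilZeroLine.dualExpCoord_map d gV hgV hinj hinj' (hex Z₀)
    change (bdRPeriodRingData hp).dualExpCoord (logCyclotomic p)
        ((restrictedRationalTateRep W F p).restrict (absGaloisRestrict F F)) (d.map gV hgV).ω
          (fun σ => TateModule.toRational p (η.1 σ)) =
      (bdRPeriodRingData hp).dualExpCoord (logCyclotomic p) (restrictedRationalTateRep W F p) d.ω
        (fun σ => TateModule.toRational p (η₀.1 σ))
    rw [hA, hB]
    rfl
  obtain ⟨e, he, h₁, -⟩ := hT₂ W hp w hp w d (d.map gV hgV) hinj hex hinj' hex' hcompat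
  exact ⟨e, he, h₁⟩

end Literature.NumberTheory.PAdicHodge

end
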